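import Literature.Computability.QuantumComplexity.IQPPostselectionProofs
import Literature.Computability.QuantumComplexity.PPPostBQPAssembly
import HarnessLib

/-!
# BJS Theorems 1–2 and Corollary 1 (uniform, multiplicative form): discharges

Topic `Literature/Computability/QuantumComplexity`; sibling of `IQPPostselection.lean` /
`IQPPostselectionProofs.lean`. The three named facts of `IQPPostselection.lean` —

* `PP_subset_PostIQPWith` (Bremner–Jozsa–Shepherd 2011, Thm. 1 in the inclusion form
  `PP ⊆ PostIQPWith ε` consumed by Thm. 2),
* `PostBPP_eq_PP_of_uniform_iqp_multiplicative` (BJS Thm. 2: a uniform multiplicative classical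
  simulation of uniform IQP families forces `PostBPP = PP`),
* `PH_eq_DeltaP_three_of_uniform_iqp_multiplicative` (BJS Cor. 1: … hence `PH = Δ₃ᵖ`),

are theorems of the tree, assembled from its two deep ingredients, both now proved:
Aaronson's inclusion `PP ⊆ PostBQP` (`PPPostBQP.PP_subset_PostBQP`, `PPPostBQPAssembly.lean`;
Aaronson 2005, Thm. 4) and the Hadamard gadget `PostBQPWith ε ⊆ PostIQPWith ε`
(`PostBQPWith_subset_PostIQPWith_holds`, `PostBQPToPostIQPProofs.lean`; BJS Thm. 1, Fig. 1), through
the reductions `PP_subset_PostIQPWith_of_subset`,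
`PostBPP_eq_PP_of_uniform_iqp_multiplicative_of_two_facts` and
`PH_eq_DeltaP_three_of_uniform_iqp_multiplicative_of_two_facts` of `IQPPostselectionProofs.lean`
(which already contain the simulation argument of Thm. 2, post-BQP error reduction, `PostBPP ⊆ PP`,
Toda's theorem and `PostBPP ⊆ Δ₃ᵖ`). A second, independent formalisation of the gadget's uniformity
half is `HGadget.isUniform_gadgetFamily_padFamily` (`HadamardGadgetDescFP.lean`).

## References

* M. J. Bremner, R. Jozsa, D. J. Shepherd, *Classical simulation of commuting quantum
  computations implies collapse of the polynomial hierarchy*, Proc. R. Soc. A 467 (2011)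
  459–472, doi:10.1098/rspa.2010.0301, arXiv:1005.1407: Thm. 1 (p. 7), Thm. 2 and its proof
  (eqs. (5)–(8), p. 8), Cor. 1 (p. 8).
* S. Aaronson, *Quantum computing, postselection, and probabilistic polynomial-time*, Proc. R.
  Soc. A 461 (2005) 3473–3482: Thm. 4 (`PP ⊆ PostBQP`).
-/

namespace Literature.Computability.QuantumComplexity

/-- **BJS Theorem 1, inclusion form** (`PP ⊆ PostIQPWith ε` for all `0 < ε < 1/2`): discharge of
`PP_subset_PostIQPWith` from Aaronson's `PP ⊆ PostBQP`, post-BQP error reduction and the Hadamard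
gadget. [cite: BremnerJozsaShepherdPRSA2011, Thm. 1] [cite: Aaronson2005, Thm. 4] -/
theorem PP_subset_PostIQPWith_holds : PP_subset_PostIQPWith :=
  PP_subset_PostIQPWith_of_subset PPPostBQP.PP_subset_PostBQP PostBQPWith_subset_PostIQPWith_holds

/-- **BJS Theorem 2** (uniform, multiplicative form, as printed: "if the output probability
distributions generated by uniform families of IQP circuits could be weakly classically simulated
to within multiplicative error `1 ≤ c < √2` then `PostBPP = PP`"): discharge of
`PostBPP_eq_PP_of_uniform_iqp_multiplicative`. [cite: BremnerJozsaShepherdPRSA2011, Thm. 2] -/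
theorem PostBPP_eq_PP_of_uniform_iqp_multiplicative_holds : PostBPP_eq_PP_of_uniform_iqp_multiplicative :=
  PostBPP_eq_PP_of_uniform_iqp_multiplicative_of_two_facts PPPostBQP.PP_subset_PostBQP
    PostBQPWith_subset_PostIQPWith_holds

/-- **BJS Corollary 1** (uniform, multiplicative form: such a simulation collapses the polynomial
hierarchy to its third level, `PH = Δ₃ᵖ`): discharge of
`PH_eq_DeltaP_three_of_uniform_iqp_multiplicative`. [cite: BremnerJozsaShepherdPRSA2011, Cor. 1] -/
theorem PH_eq_DeltaP_three_of_uniform_iqp_multiplicative_holds : PH_eq_DeltaP_three_of_uniform_iqp_multiplicative :=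
  PH_eq_DeltaP_three_of_uniform_iqp_multiplicative_of_two_facts PPPostBQP.PP_subset_PostBQP
    PostBQPWith_subset_PostIQPWith_holds

end Literature.Computability.QuantumComplexity
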